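import Summits.PneNP.PneNP.Theorems.ChebyshevTracialDesignTiltedJuntaExpansion
import Summits.PneNP.PneNP.Theorems.ChebyshevTracialDesignInSetPieces
import Summits.PneNP.PneNP.Theorems.ChebyshevTracialDesignBlockEdgeSwaps
import HarnessLib

/-!
# Cell pnp-psdrank, route `ChebyshevTracialDesign`: TILTED JUNTAS ON A SMALL BLOCK, ONE CLASS — the junta crossing-plane form priced
# (brick J3 = 162c; crux `TracialDecayExp20`, stmt-PneNP-19878)

Brick 162c (prover g31; MEMO-34 §6). **`tiltedJunta_levelSum_le`**: exact design `(n,t,T,D,B_v,C,w)`; a `π`-stable ground set `S` with `N'` edges;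
a block `H` with NO edge of `S` inside and `b` edges meeting it; reduced cut `2s₀+c₀`, level shift `g ≤ T`, `R ≥ 1` admissible as in brick 151
(`R + 3(D′+1) + b + (T−1)/2 ≤ s₀`, `… + s₀ + 2 ≤ N'`, `(b/R)²e^{3b/R} ≤ 2`); a JUNTA mask `0 ≤ f ≤ G` of the in-set; vertex tilt coefficients
`|α_v| ≤ 4`, `|κ| ≤ 1`, `|L| ≤ L₀`; a polynomial level weight `p` (`deg p + 2 + D′ ≤ D`, `p(0) ≥ 0`, `p(0) = 0` unless `g = 0`, `p = 0` below `g`,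
`|p| ≤ P` on the levels). Then
`Σ_c w_c p(c)·E_{Shell_S(2s₀+c₀, c−g)}[f(U∩H)·(A(U∩H) − Σ_{v∈S∩H} α_vY_v + L − κc)²] ≤ B_v·P·C((T−1)/2, D′+1)·G·(4b+L₀+5T+4)²·q_b^{D′+1}`,
`q_b = ¼(b/R)²e^{3b/R}`. This single statement contains brick 151 (`α` constant, `f = ψ(|·|)`) and brick 158 (`α` two-valued, bivariate `Ψ`) and is
the engine for EVERY junta mask in every colour-type-constant direction. Seven pieces (162b): the main piece one-sidedly (157d `piece_main_le_inset`)
when `g = 0`, six pure remainders (157d `piece_abs_le_inset` — every junta of the in-set averages to its symmetrisation, 157c); helper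
`abs_levelSum_coeff_le`, `sum_card_sdiff_pair_le'`. The proof term is large (`maxHeartbeats 400000`, measured need ≈ 250k).
[cite: Rothvoss2017, §2 (PDF p. 6)] [cite: Agarwal2000DifferenceEquations, Remark 1.8.1 (1.8.8)] [cite: RollinRoss2010, §3 (Lemma 3.1)]
Stature: support/instrument (kernel lane, no defs, axioms standard). WHAT THIS IS NOT: nothing on spread / non-junta masks (the open heart, N2), no proof or refutation of
`TracialDecayExp20`, nothing on psd rank of P_PM(K_n), no P-vs-NP content. Supports stmt-PneNP-19878.
-/

set_option linter.dupNamespace false -- `Summit.PneNP.PneNP.…`: summit = sub-problem (D-0017)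

noncomputable section

namespace Summit.PneNP.PneNP.Theorems.ChebyshevTracialDesignTiltedJunta

open Finset Polynomial Literature.Barriers.PneNP Literature.Combinatorics.Optimization
open Literature.Combinatorics.Optimization.ShellStep
open Summit.PneNP.PneNP.Theorems.ChebyshevTracialDesignTiltedSmallBlockTools
  (reps_vAA_card_eq_zero_of_subset reps_vB_card_le_of_subset shellIn_nonempty_of_add_le)
open Summit.PneNP.PneNP.Theorems.ChebyshevTracialDesignTiltedSmallBlockExpansion
  (abs_div_mul_sum_le abs_div_mul_sum_sum_le weights_natDegree_le weights_abs_eval_le card_inter_mul_pred_le)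
open Summit.PneNP.PneNP.Theorems.ChebyshevTracialDesignBlockEdgeSwaps (card_reps_vB_eq_card_inter)
open Summit.PneNP.PneNP.Theorems.ChebyshevTracialDesignInSetPieces (piece_abs_le_inset piece_main_le_inset)
open Summit.PneNP.PneNP.Theorems.ChebyshevTracialDesignTiltedJuntaExpansion

variable {n : ℕ}

/-- Pulling a constant coefficient out of a level sum: `|Σ_c w_c·e_c·(a·X_c)| ≤ a₀·B` if `|a| ≤ a₀` and `|Σ_c w_c·e_c·X_c| ≤ B`.
[cite: Rothvoss2017, §2 (PDF p. 6)] -/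
theorem abs_levelSum_coeff_le {C : Finset ℕ} (w e X : ℕ → ℝ) {a a₀ B : ℝ} (ha : |a| ≤ a₀)
    (h : |∑ c ∈ C, w c * (e c * X c)| ≤ B) : |∑ c ∈ C, w c * (e c * (a * X c))| ≤ a₀ * B := by
  have e1 : ∑ c ∈ C, w c * (e c * (a * X c)) = a * ∑ c ∈ C, w c * (e c * X c) := by
    rw [mul_sum]; exact sum_congr rfl fun c _ => by ring
  rw [e1, abs_mul]
  exact mul_le_mul ha h (abs_nonneg _) ((abs_nonneg _).trans ha)

section Main

variable {π : Fin n → Fin n} (hπ : ∀ v, π (π v) = v) (hπ' : ∀ v, π v ≠ v)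
include hπ hπ'

omit hπ hπ' in
/-- In a stable ground set with no edge inside `H`, `Σ_{v∈S∩H} |(S∩H)∖e_v| ≤ |S|(|S|−2)` (`|S| ≥ 2`; real form).
[cite: Rothvoss2017, §2 (PDF p. 5)] -/
theorem sum_card_sdiff_pair_le' {S : Finset (Fin n)} (hS : ∀ v ∈ S, π v ∈ S) (H : Finset (Fin n))
    (hno : ∀ v ∈ S, ¬ (v ∈ H ∧ π v ∈ H)) (h2 : 2 ≤ S.card) :
    (∑ v ∈ S ∩ H, ((((S ∩ H) \ {v, π v}).card : ℕ) : ℝ)) ≤ (S.card : ℝ) * ((S.card : ℝ) - 2) := by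
  have h1 : ∀ v ∈ S ∩ H, ((S ∩ H) \ {v, π v}).card ≤ (S ∩ H).card - 1 := by
    intro v hv
    have : (S ∩ H) \ {v, π v} ⊆ (S ∩ H).erase v := by
      intro u hu
      rw [mem_sdiff, mem_insert, not_or] at hu
      exact mem_erase.2 ⟨hu.2.1, hu.1⟩
    exact (card_le_card this).trans (by rw [card_erase_of_mem hv])
  have h2' : ∑ v ∈ S ∩ H, ((S ∩ H) \ {v, π v}).card ≤ S.card * (S.card - 2) :=
    calc ∑ v ∈ S ∩ H, ((S ∩ H) \ {v, π v}).card ≤ ∑ v ∈ S ∩ H, ((S ∩ H).card - 1) := sum_le_sum h1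
      _ = (S ∩ H).card * ((S ∩ H).card - 1) := by rw [sum_const, smul_eq_mul]
      _ ≤ (S.card - 1) * (S.card - 2) := card_inter_mul_pred_le hS H hno h2
      _ ≤ S.card * (S.card - 2) := Nat.mul_le_mul_right _ (Nat.sub_le _ _)
  have h3 : ((∑ v ∈ S ∩ H, ((S ∩ H) \ {v, π v}).card : ℕ) : ℝ) ≤ ((S.card * (S.card - 2) : ℕ) : ℝ) := by
    exact_mod_cast h2'
  rw [Nat.cast_sum, Nat.cast_mul, Nat.cast_sub h2] at h3
  simpa using h3

set_option maxHeartbeats 400000 in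
/-- **TILTED JUNTAS ON A SMALL BLOCK, ONE CLASS: THE JUNTA CROSSING-PLANE FORM PRICED (brick J3).** Exact design `(n,t,T,D,B_v,C,w)` (its
rule); a `π`-stable ground set `S` with `N'` edges; a block `H` with NO edge of `S` inside and `b` edges meeting it; the reduced cut `2s₀+c₀`
(`c₀ ≤ 1`), a level shift `g ≤ T` and base `i₀` with `2i₀+1 = g+c₀`; `R ≥ 1`, `R + 3(D′+1) + b + (T−1)/2 ≤ s₀`,
`R + 3(D′+1) + b + s₀ + (T−1)/2 + 2 ≤ N'`, `(b/R)²e^{3b/R} ≤ 2`; a JUNTA mask `0 ≤ f ≤ G` of the in-set; vertex tilt coefficients `|α_v| ≤ 4`,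
`|κ| ≤ 1`, `|L| ≤ L₀`; a polynomial level weight `p` with `deg p + 2 + D′ ≤ D`, `p(0) ≥ 0`, `p(0) = 0` unless `g = 0`, `p = 0` on the levels
`< g`, `|p| ≤ P` on the levels. Then, with `A(I) = Σ_{v∈I} α_v` and `Y_v = [v ∈ half U]`,
`Σ_c w_c p(c)·E_{Shell_S(2s₀+c₀, c−g)}[f(U∩H)·(A(U∩H) − Σ_{v∈S∩H} α_vY_v + L − κc)²] ≤ B_v·P·C((T−1)/2, D′+1)·G·(4b+L₀+5T+4)²·q_b^{D′+1}`.
This single statement contains brick 151 (`α` constant, `f = ψ(|·|)`) and brick 158 (`α` two-valued, `f = Ψ(|·∩H₁|,|·∩H₂|)`) and covers every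
junta mask in every colour-type-constant direction (after 148 §4). Seven pieces (brick J2): main piece one-sidedly (157d `piece_main_le_inset`)
when `g = 0`, the six others pure remainders on `S`, `S∖e_v`, `S∖e_v∖e_w` (157d `piece_abs_le_inset`: every junta of the in-set averages to its
symmetrisation, 157c); brick 151's assembly polynomial (`seven_piece_bound`). [cite: Rothvoss2017, §2 (PDF p. 6)]
[cite: Agarwal2000DifferenceEquations, Remark 1.8.1 (1.8.8)] [cite: RollinRoss2010, §3 (Lemma 3.1)] -/
theorem tiltedJunta_levelSum_le {t T D : ℕ} {Bv : ℝ} {C : Finset ℕ} {w : ℕ → ℝ}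
    (hdes : IsExactDesign n t T D Bv C w)
    {S : Finset (Fin n)} (hS : ∀ v ∈ S, π v ∈ S) {N' : ℕ} (hN : S.card = 2 * N')
    (H : Finset (Fin n)) (h0 : (reps π (vAA π S H)).card = 0)
    {b : ℕ} (hb : (reps π (vBH π S H ∪ vBN π S H)).card = b)
    {s₀ c₀ i₀ g D' R : ℕ} (hc₀ : c₀ ≤ 1) (hi₀ : 2 * i₀ + 1 = g + c₀) (hgT : g ≤ T) (hR : 1 ≤ R)
    (hR1 : R + 3 * (D' + 1) + b + (T - 1) / 2 ≤ s₀)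
    (hR2 : R + 3 * (D' + 1) + b + s₀ + (T - 1) / 2 + 2 ≤ N')
    (hq : ((b : ℝ) / R) ^ 2 * Real.exp (3 * b / R) ≤ 2)
    (f : Finset (Fin n) → ℝ) {G : ℝ} (hG : ∀ I, |f I| ≤ G) (hf0 : ∀ I, 0 ≤ f I)
    (α : Fin n → ℝ) (hα : ∀ v, |α v| ≤ 4) (kap L : ℝ) {L₀ : ℝ} (hkap : |kap| ≤ 1) (hL : |L| ≤ L₀)
    (p : ℝ[X]) (hdeg : p.natDegree + 2 + D' ≤ D) (hp0 : 0 ≤ p.eval 0) (hpg : g ≠ 0 → p.eval 0 = 0)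
    (hpC : ∀ c ∈ C, c < g → p.eval (c : ℝ) = 0) {P : ℝ} (hP : ∀ c ∈ C, |p.eval (c : ℝ)| ≤ P) :
    ∑ c ∈ C, w c * (p.eval (c : ℝ) *
        ((∑ U ∈ shellIn π S (2 * s₀ + c₀) (c - g), f (U ∩ H) *
            ((∑ v ∈ U ∩ H, α v) - (∑ v ∈ S ∩ H, α v * (if (v ∈ U ∧ π v ∉ U) then (1 : ℝ) else 0)) + L - kap * c) ^ 2) /
          ((shellIn π S (2 * s₀ + c₀) (c - g)).card : ℝ))) ≤
      Bv * P * ((((T - 1) / 2).choose (D' + 1) : ℕ) : ℝ) *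
        (G * (4 * (b : ℝ) + L₀ + 5 * T + 4) ^ 2 * ((1 / 4 : ℝ) * ((b : ℝ) / R) ^ 2 * Real.exp (3 * b / R)) ^ (D' + 1)) := by
  classical
  -- basic facts
  set q : ℝ := (1 / 4 : ℝ) * ((b : ℝ) / R) ^ 2 * Real.exp (3 * b / R) with hqdef
  have hq0 : 0 ≤ q := by rw [hqdef]; positivity
  set Kc : ℝ := ((((T - 1) / 2).choose (D' + 1) : ℕ) : ℝ) with hKc
  have hKc0 : 0 ≤ Kc := Nat.cast_nonneg _
  have hG0 : 0 ≤ G := (abs_nonneg _).trans (hG ∅)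
  have hBv : 0 ≤ Bv := (sum_nonneg fun c _ => abs_nonneg (w c)).trans hdes.variation_le
  obtain ⟨c₁, hc₁⟩ : C.Nonempty := by
    by_contra h
    have := hdes.2.2.2.2.1
    rw [not_nonempty_iff_eq_empty.1 h, sum_empty] at this
    exact zero_ne_one this
  have hP0 : 0 ≤ P := (abs_nonneg _).trans (hP c₁ hc₁)
  have hlev : ∀ c ∈ C, (∃ j, c = 2 * j + 1) ∧ 3 ≤ c ∧ c ≤ T := by
    intro c hc
    obtain ⟨hodd, h3, hcT, _⟩ := hdes.2.2.2.1 c hc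
    exact ⟨hodd.imp fun j hj => by omega, h3, hcT⟩
  have hT0 : (0 : ℝ) ≤ T := Nat.cast_nonneg T
  have hnoHH := noHH_of_card_reps_vAA_eq_zero hπ hπ' hS H h0
  have hScard : (4 : ℝ) ≤ S.card := by exact_mod_cast (show 4 ≤ S.card by omega)
  have hL₀ : 0 ≤ L₀ := (abs_nonneg _).trans hL
  set Λ₁ : ℝ := 4 * (b : ℝ) + L₀ with hΛ₁
  have hΛ₁0 : 0 ≤ Λ₁ := by rw [hΛ₁]; positivity
  have hbS : (S ∩ H).card ≤ b := by rw [← card_reps_vB_eq_card_inter hπ hπ' hS H hnoHH, hb]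
  have hbS' : ∀ S' ⊆ S, (S' ∩ H).card ≤ b := fun S' hS' =>
    (card_le_card (inter_subset_inter_right hS')).trans hbS
  -- masks
  obtain ⟨hM2, hM2', hM1, hM1s⟩ := junta_mask_bounds (π := π) f hG hf0 α hα hL hbS
  -- nonempty shells at the levels `c ≥ g + 1`
  have hne : ∀ c ∈ C, g + 1 ≤ c → (shellIn π S (2 * s₀ + c₀) (c - g)).Nonempty := by
    intro c hc hgc
    obtain ⟨⟨j, rfl⟩, _, hcT⟩ := hlev c hc
    have h := shellIn_nonempty_of_add_le hπ hπ' hS hN (s := s₀ + i₀ - j) (c := 2 * j + 1 - g) (by omega)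
    rwa [show 2 * (s₀ + i₀ - j) + (2 * j + 1 - g) = 2 * s₀ + c₀ by omega] at h
  -- a level below the base is not a design level (parity)
  have hbase : ∀ c ∈ C, c < g + c₀ → p.eval (c : ℝ) = 0 := by
    intro c hc hlt
    obtain ⟨⟨j, rfl⟩, _, _⟩ := hlev c hc
    rcases lt_or_ge (2 * j + 1) g with h | h
    · exact hpC _ hc h
    · exfalso; omega
  have hp0g : p.eval 0 * (g : ℝ) = 0 := by
    rcases Nat.eq_zero_or_pos g with h | h
    · rw [h, Nat.cast_zero, mul_zero]
    · rw [hpg (by omega), zero_mul]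
  -- degrees and level bounds of the five derived weights
  obtain ⟨hdX, hdX2, hdg, hdXg, hdgg⟩ := weights_natDegree_le p (g : ℝ) ((g : ℝ) + 1) hdeg
  have hgT' : (g : ℝ) ≤ T := by exact_mod_cast hgT
  obtain ⟨hPX, hPX2, hPg, hPXg, hPgg⟩ := weights_abs_eval_le p C hP hP0 (Nat.cast_nonneg g) hgT'
    (fun c hc => by obtain ⟨_, h3, hcT⟩ := hlev c hc; exact ⟨by exact_mod_cast h3, by exact_mod_cast hcT⟩)
  -- expand
  have ht2 : 2 ≤ 2 * s₀ + c₀ := by omega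
  rw [levelSum_tilted_expand_J hπ hπ' hS H ht2 g C w p hpC hne f α kap L]
  -- ground-set data of the deleted instances
  have hSv : ∀ v ∈ S, (∀ u ∈ S \ {v, π v}, π u ∈ S \ {v, π v}) ∧ (S \ {v, π v}).card = 2 * (N' - 1) ∧
      (reps π (vAA π (S \ {v, π v}) H)).card = 0 ∧
      (reps π (vBH π (S \ {v, π v}) H ∪ vBN π (S \ {v, π v}) H)).card ≤ b := by
    intro v hvS
    have hc := card_sdiff_pair hπ' hS hvS
    exact ⟨sdiff_pair_stable hπ hS v, by omega, reps_vAA_card_eq_zero_of_subset sdiff_subset _ h0,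
      hb ▸ reps_vB_card_le_of_subset sdiff_subset _⟩
  have hSvw : ∀ v ∈ S, ∀ w' ∈ S, w' ≠ v → w' ≠ π v →
      (∀ u ∈ del2 π S v w', π u ∈ del2 π S v w') ∧ (del2 π S v w').card = 2 * (N' - 2) ∧
      (reps π (vAA π (del2 π S v w') H)).card = 0 ∧
      (reps π (vBH π (del2 π S v w') H ∪ vBN π (del2 π S v w') H)).card ≤ b := by
    intro v hvS w' hw'S h1 h2
    have hc := card_del2 hπ hπ' hS hvS hw'S h1 h2
    rw [hN] at hc
    push_cast at hc
    have hc' : (del2 π S v w').card = 2 * (N' - 2) := by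
      have e : ((del2 π S v w').card : ℝ) = ((2 * (N' - 2) : ℕ) : ℝ) := by
        rw [hc, Nat.cast_mul, Nat.cast_sub (by omega)]; push_cast; ring
      exact_mod_cast e
    have hsub : del2 π S v w' ⊆ S := by intro u hu; exact (mem_del2.1 hu).1
    exact ⟨del2_stable hπ hS v w', hc', reps_vAA_card_eq_zero_of_subset hsub _ h0, hb ▸ reps_vB_card_le_of_subset hsub _⟩
  -- the reduced cut one vertex down: `2s₀ + c₀ − 1 = 2s₁ + c₁`, base `i₁`
  obtain ⟨s₁, c₁, i₁, hs₁, hi₁, hc₁, hs₁le⟩ : ∃ s₁ c₁ i₁ : ℕ, 2 * s₀ + c₀ - 1 = 2 * s₁ + c₁ ∧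
      2 * i₁ + 1 = g + 1 + c₁ ∧ c₁ ≤ 1 ∧ s₁ ≤ s₀ ∧ s₀ ≤ s₁ + 1 := by
    rcases Nat.eq_zero_or_pos c₀ with h | h
    · exact ⟨s₀ - 1, 1, i₀ + 1, by omega, by omega, le_rfl, by omega, by omega⟩
    · exact ⟨s₀, 0, i₀, by omega, by omega, by omega, le_rfl, by omega⟩
  have hi₂ : 2 * (i₀ + 1) + 1 = (g + 2) + c₀ := by omega
  -- derived weights: virtual vanishing and bases
  have hwg0 : (p * (X - Polynomial.C (g : ℝ))).eval 0 = 0 := by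
    rw [eval_mul, eval_sub, eval_X, eval_C, zero_sub, mul_neg, hp0g, neg_zero]
  have hwXg0 : (p * X * (X - Polynomial.C (g : ℝ))).eval 0 = 0 := by simp
  have hbase1 : ∀ c ∈ C, c < 2 * i₁ + 1 → (p * (X - Polynomial.C (g : ℝ))).eval (c : ℝ) = 0 := by
    intro c hc hlt
    obtain ⟨⟨j, rfl⟩, _, _⟩ := hlev c hc
    rcases lt_trichotomy (2 * j + 1) g with h | h | h
    · rw [eval_mul, hpC _ hc h, zero_mul]
    · rw [eval_mul, eval_sub, eval_X, eval_C, ← h]; push_cast; ring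
    · exfalso; omega
  have hbase1' : ∀ c ∈ C, c < 2 * i₁ + 1 → (p * X * (X - Polynomial.C (g : ℝ))).eval (c : ℝ) = 0 := by
    intro c hc hlt
    have h := hbase1 c hc hlt
    rw [eval_mul] at h
    rw [eval_mul, eval_mul, eval_X, mul_assoc, mul_comm (c : ℝ), ← mul_assoc, h, zero_mul]
  have hwgg0 : (p * (X - Polynomial.C (g : ℝ)) * (X - Polynomial.C ((g : ℝ) + 1))).eval 0 = 0 := by
    rw [eval_mul, hwg0, zero_mul]
  have hbase2 : ∀ c ∈ C, c < 2 * (i₀ + 1) + 1 →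
      (p * (X - Polynomial.C (g : ℝ)) * (X - Polynomial.C ((g : ℝ) + 1))).eval (c : ℝ) = 0 := by
    intro c hc hlt
    obtain ⟨⟨j, rfl⟩, _, _⟩ := hlev c hc
    rcases lt_trichotomy (2 * j + 1) (g + 1) with h | h | h
    · rw [eval_mul, hbase1 _ hc (by omega), zero_mul]
    · rw [eval_mul, eval_sub, eval_X, eval_C, show ((2 * j + 1 : ℕ) : ℝ) = (g : ℝ) + 1 by exact_mod_cast h]
      ring
    · exfalso; omega
  -- === T0: the main piece
  have hB0 : ∑ c ∈ C, w c * (p.eval (c : ℝ) *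
      ((∑ U ∈ shellIn π S (2 * s₀ + c₀) (c - g), (fun I => f I * ((∑ v ∈ I, α v) + L) ^ 2) (U ∩ H)) /
        ((shellIn π S (2 * s₀ + c₀) (c - g)).card : ℝ))) ≤ Bv * P * Kc * (G * Λ₁ ^ 2 * q ^ (D' + 1)) := by
    rcases Nat.eq_zero_or_pos g with hg0 | hgpos
    · subst hg0
      have hc₀1 : c₀ = 1 := by omega
      subst hc₀1
      simp only [Nat.sub_zero]
      have h := piece_main_le_inset hπ hπ' hdes hS hN H h0 hb le_rfl (s₀ := s₀) (D' := D') hR (by omega) (by omega) hq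
        (fun I => f I * ((∑ v ∈ I, α v) + L) ^ 2) (by positivity) hM2 hM2' p (by omega) hp0 hP
      rw [← hqdef, ← hKc] at h
      exact h
    · have hpz : p.eval 0 = 0 := hpg (by omega)
      have h := piece_abs_le_inset hπ hπ' hdes hS hN H h0 hb le_rfl (s₀ := s₀) (D' := D') hi₀ hR (by omega) (by omega)
        (fun I => f I * ((∑ v ∈ I, α v) + L) ^ 2) (by positivity) hM2 p (by omega) hpz
        (fun c hc hlt => hbase c hc (by omega)) hP
      rw [← hqdef, ← hKc] at h
      exact (le_abs_self _).trans h
  -- === T1, T2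
  have hB1 : |∑ c ∈ C, w c * ((p * X).eval (c : ℝ) *
      ((∑ U ∈ shellIn π S (2 * s₀ + c₀) (c - g), (fun I => f I * ((∑ v ∈ I, α v) + L)) (U ∩ H)) /
        ((shellIn π S (2 * s₀ + c₀) (c - g)).card : ℝ)))| ≤ Bv * (P * T) * Kc * (G * Λ₁ * q ^ (D' + 1)) := by
    have h := piece_abs_le_inset hπ hπ' hdes hS hN H h0 hb le_rfl (s₀ := s₀) (D' := D') hi₀ hR (by omega) (by omega)
      (fun I => f I * ((∑ v ∈ I, α v) + L)) (by positivity) hM1 (p * X) hdX (by simp)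
      (fun c hc hlt => by rw [eval_mul, hbase c hc (by omega), zero_mul]) hPX
    rw [← hqdef, ← hKc] at h
    exact h
  have hB2 : |∑ c ∈ C, w c * ((p * X ^ 2).eval (c : ℝ) *
      ((∑ U ∈ shellIn π S (2 * s₀ + c₀) (c - g), f (U ∩ H)) /
        ((shellIn π S (2 * s₀ + c₀) (c - g)).card : ℝ)))| ≤ Bv * (P * T ^ 2) * Kc * (G * q ^ (D' + 1)) := by
    have h := piece_abs_le_inset hπ hπ' hdes hS hN H h0 hb le_rfl (s₀ := s₀) (D' := D') hi₀ hR (by omega) (by omega)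
      f hG0 (fun I _ => hG I) (p * X ^ 2) hdX2 (by simp) (fun c hc hlt => by rw [eval_mul, hbase c hc (by omega), zero_mul]) hPX2
    rw [← hqdef, ← hKc] at h
    exact h
  -- === one vertex pinned (ground set `S ∖ e_v`, cut `2s₁+c₁`, shift `g+1`, base `i₁`)
  have hα2 : ∀ v w' : Fin n, |α v * α w'| ≤ 16 := fun v w' => by
    rw [abs_mul]; nlinarith [hα v, hα w', abs_nonneg (α v), abs_nonneg (α w')]
  have hαsq : ∀ v : Fin n, |α v ^ 2| ≤ 16 := fun v => by rw [pow_two]; exact hα2 v v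
  have hB3 : ∀ v ∈ S ∩ H, |∑ c ∈ C, w c * ((p * (X - Polynomial.C (g : ℝ))).eval (c : ℝ) *
      (α v * ((∑ W ∈ shellIn π (S \ {v, π v}) (2 * s₀ + c₀ - 1) (c - g - 1),
          (fun J => f (insert v J) * ((∑ u ∈ insert v J, α u) + L)) (W ∩ H)) /
        ((shellIn π (S \ {v, π v}) (2 * s₀ + c₀ - 1) (c - g - 1)).card : ℝ))))| ≤
      4 * (Bv * (P * T) * Kc * (G * Λ₁ * q ^ (D' + 1))) := by
    intro v hv
    obtain ⟨hst, hcard, h0v, hbv⟩ := hSv v (mem_inter.1 hv).1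
    have h := piece_abs_le_inset hπ hπ' hdes hst hcard H h0v rfl hbv (s₀ := s₁) (D' := D') hi₁ hR (by omega) (by omega)
      (fun J => f (insert v J) * ((∑ u ∈ insert v J, α u) + L)) (by positivity) (hM1s v hv)
      (p * (X - Polynomial.C (g : ℝ))) hdg hwg0 hbase1 hPg
    rw [← hqdef, ← hKc, ← hs₁] at h
    simp only [Nat.sub_sub] at h ⊢
    exact abs_levelSum_coeff_le _ _ _ (hα v) h
  have hB4 : ∀ v ∈ S ∩ H, |∑ c ∈ C, w c * ((p * X * (X - Polynomial.C (g : ℝ))).eval (c : ℝ) *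
      (α v * ((∑ W ∈ shellIn π (S \ {v, π v}) (2 * s₀ + c₀ - 1) (c - g - 1), (fun J => f (insert v J)) (W ∩ H)) /
        ((shellIn π (S \ {v, π v}) (2 * s₀ + c₀ - 1) (c - g - 1)).card : ℝ))))| ≤
      4 * (Bv * (P * T ^ 2) * Kc * (G * q ^ (D' + 1))) := by
    intro v hv
    obtain ⟨hst, hcard, h0v, hbv⟩ := hSv v (mem_inter.1 hv).1
    have h := piece_abs_le_inset hπ hπ' hdes hst hcard H h0v rfl hbv (s₀ := s₁) (D' := D') hi₁ hR (by omega) (by omega)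
      (fun J => f (insert v J)) hG0 (fun J _ => hG _) (p * X * (X - Polynomial.C (g : ℝ))) hdXg hwXg0 hbase1' hPXg
    rw [← hqdef, ← hKc, ← hs₁] at h
    simp only [Nat.sub_sub] at h ⊢
    exact abs_levelSum_coeff_le _ _ _ (hα v) h
  have hB5 : ∀ v ∈ S ∩ H, |∑ c ∈ C, w c * ((p * (X - Polynomial.C (g : ℝ))).eval (c : ℝ) *
      (α v ^ 2 * ((∑ W ∈ shellIn π (S \ {v, π v}) (2 * s₀ + c₀ - 1) (c - g - 1), (fun J => f (insert v J)) (W ∩ H)) /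
        ((shellIn π (S \ {v, π v}) (2 * s₀ + c₀ - 1) (c - g - 1)).card : ℝ))))| ≤
      16 * (Bv * (P * T) * Kc * (G * q ^ (D' + 1))) := by
    intro v hv
    obtain ⟨hst, hcard, h0v, hbv⟩ := hSv v (mem_inter.1 hv).1
    have h := piece_abs_le_inset hπ hπ' hdes hst hcard H h0v rfl hbv (s₀ := s₁) (D' := D') hi₁ hR (by omega) (by omega)
      (fun J => f (insert v J)) hG0 (fun J _ => hG _) (p * (X - Polynomial.C (g : ℝ))) hdg hwg0 hbase1 hPg
    rw [← hqdef, ← hKc, ← hs₁] at h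
    simp only [Nat.sub_sub] at h ⊢
    exact abs_levelSum_coeff_le _ _ _ (hαsq v) h
  -- === two vertices pinned (ground set `S ∖ e_v ∖ e_w`, cut `2(s₀−1)+c₀`, shift `g+2`, base `i₀+1`)
  have hB6 : ∀ v ∈ S ∩ H, ∀ w' ∈ (S ∩ H) \ {v, π v},
      |∑ c ∈ C, w c * ((p * (X - Polynomial.C (g : ℝ)) * (X - Polynomial.C ((g : ℝ) + 1))).eval (c : ℝ) *
      (α v * α w' * ((∑ W ∈ shellIn π (del2 π S v w') (2 * s₀ + c₀ - 2) (c - g - 2),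
          (fun J => f (insert v (insert w' J))) (W ∩ H)) /
        ((shellIn π (del2 π S v w') (2 * s₀ + c₀ - 2) (c - g - 2)).card : ℝ))))| ≤
      16 * (Bv * (P * T ^ 2) * Kc * (G * q ^ (D' + 1))) := by
    intro v hv w' hw'
    have hvS : v ∈ S := (mem_inter.1 hv).1
    obtain ⟨hw'SH, hw'e⟩ := mem_sdiff.1 hw'
    rw [mem_insert, mem_singleton, not_or] at hw'e
    obtain ⟨hst, hcard, h0v, hbv⟩ := hSvw v hvS w' (mem_inter.1 hw'SH).1 hw'e.1 hw'e.2
    have h := piece_abs_le_inset hπ hπ' hdes hst hcard H h0v rfl hbv (s₀ := s₀ - 1) (D' := D') hi₂ hR (by omega)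
      (by omega) (fun J => f (insert v (insert w' J))) hG0 (fun J _ => hG _)
      (p * (X - Polynomial.C (g : ℝ)) * (X - Polynomial.C ((g : ℝ) + 1))) hdgg hwgg0 hbase2 hPgg
    rw [← hqdef, ← hKc, show 2 * (s₀ - 1) + c₀ = 2 * s₀ + c₀ - 2 by omega] at h
    simp only [Nat.sub_sub] at h ⊢
    exact abs_levelSum_coeff_le _ _ _ (hα2 v w') h
  -- === sums over the pinned vertices
  have hSpos : (0 : ℝ) < S.card := by linarith only [hScard]
  have hV : ((S ∩ H).card : ℝ) ≤ S.card := by exact_mod_cast card_le_card inter_subset_left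
  have hD0 : (0 : ℝ) < (S.card : ℝ) * ((S.card : ℝ) - 2) := mul_pos hSpos (by linarith only [hScard])
  have hpairs := sum_card_sdiff_pair_le' hS H hnoHH (by omega)
  have h2abs : |(2 : ℝ)| ≤ 2 := by norm_num
  have h1abs : |(1 : ℝ)| ≤ 1 := by norm_num
  have h2k : |2 * kap| ≤ 2 := by rw [abs_mul]; norm_num; linarith [hkap, abs_nonneg kap]
  have hK3 := abs_div_mul_sum_le (S ∩ H) _ (by positivity) hB3 hSpos hV h2abs
  have hK4 := abs_div_mul_sum_le (S ∩ H) _ (by positivity) hB4 hSpos hV h2k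
  have hK5 := abs_div_mul_sum_le (S ∩ H) _ (by positivity) hB5 hSpos hV h1abs
  have hK6 := abs_div_mul_sum_sum_le (S ∩ H) (fun v => (S ∩ H) \ {v, π v}) _ (by positivity) hB6 hD0 hpairs h1abs
  -- === the scalar pieces
  have hK1 : |2 * kap * ∑ c ∈ C, w c * ((p * X).eval (c : ℝ) *
      ((∑ U ∈ shellIn π S (2 * s₀ + c₀) (c - g), (fun I => f I * ((∑ v ∈ I, α v) + L)) (U ∩ H)) /
        ((shellIn π S (2 * s₀ + c₀) (c - g)).card : ℝ)))| ≤ 2 * (Bv * (P * T) * Kc * (G * Λ₁ * q ^ (D' + 1))) := by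
    rw [abs_mul, abs_mul, abs_of_pos (by norm_num : (0:ℝ) < 2)]
    have : 2 * |kap| ≤ 2 := by linarith only [hkap]
    exact mul_le_mul this hB1 (abs_nonneg _) (by norm_num)
  have hK2 : |kap ^ 2 * ∑ c ∈ C, w c * ((p * X ^ 2).eval (c : ℝ) *
      ((∑ U ∈ shellIn π S (2 * s₀ + c₀) (c - g), f (U ∩ H)) /
        ((shellIn π S (2 * s₀ + c₀) (c - g)).card : ℝ)))| ≤ 1 * (Bv * (P * T ^ 2) * Kc * (G * q ^ (D' + 1))) := by
    rw [abs_mul, abs_pow]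
    have : |kap| ^ 2 ≤ 1 := pow_le_one₀ (abs_nonneg _) hkap
    exact mul_le_mul this hB2 (abs_nonneg _) (by norm_num)
  -- === assembly
  exact seven_piece_bound hBv hP0 hKc0 hG0 (pow_nonneg hq0 _) hT0 hΛ₁0 hB0 hK1 hK2 hK3 hK4 hK5 hK6

end Main

end Summit.PneNP.PneNP.Theorems.ChebyshevTracialDesignTiltedJunta

end
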